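import Mathlib.RingTheory.Idempotents
import Mathlib.RingTheory.Etale.Pi
import Literature.AlgebraicGeometry.Resolution.NormalizationSection
import HarnessLib

/-!
# Splitting an integral algebra along the idempotents of an ambient product of fields

Topic: `Literature/AlgebraicGeometry/Resolution`. Pure algebra serving de Jong 1996, 4.12 (p. 68:
"Let `X' → Y' → ℙ^{d-1}` be the Stein factorization of `f`. Note that `Y' → ℙ^{d-1}` is (finite)
étale, in view of property (ii) b) of the lemma", the named fact
`DeJong1996SteinFactorizationEtale` of `AlterationsFibresConnected.lean`). After an étale base
change `U = Spec R → ℙ^{d-1}` carrying sections of `f` through smooth points of a fibre, the ring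
`B = Γ(X'_U, 𝒪)` (integral over `R`) sits inside `E = R ⊗ K(X')`, a finite product of fields
(étale over the field `K(X')`), and is integrally closed in it (`X'` is normal; Stacks 03GE). The
algebra of that situation is isolated here, with no geometry:

* `isIntegral_of_isIdempotentElem` — idempotents are integral (roots of `X² - X`);
* `exists_completeOrthogonalIdempotents_of_integrallyClosedIn` — if `B → E` is injective, `B`
  is integrally closed in `E` and `E ≃ ∏ᵢ Fᵢ` (fields), the standard idempotents of `E` come
  from complete orthogonal idempotents `eᵢ ∈ B`, and `B ⧸ (1 - eᵢ) ↪ Fᵢ`: the ideal `(1 - eᵢ)`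
  is the kernel of `B → Fᵢ`, so each `B ⧸ (1 - eᵢ)` is a domain
  (`isDomain_quotient_span_one_sub`);
* `bijective_algebraMap_of_retraction` — an `R`-algebra which is a domain, integral over `R`
  and admits an `R`-algebra retraction to `R` IS `R` (from
  `eq_algebraMap_of_retraction_of_isIntegral`, `NormalizationSection.lean`);
  `exists_retraction_quotient` builds the retraction of `B ⧸ (1 - eᵢ)` from `s : B →ₐ[R] R`
  with `s eᵢ = 1` (`bijective_algebraMap_quotient_of_apply_eq_one` combines the two), and
  `apply_idem_eq_zero_or_one` / `exists_apply_idem_eq_one` record that `s eᵢ ∈ {0, 1}`, with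
  the value `1` attained, when `R` has only trivial idempotents;
* `exists_algEquiv_pi_of_bijective`, `etale_of_completeOrthogonalIdempotents_of_bijective` —
  if every `R → B ⧸ (1 - eᵢ)` is bijective then `B ≃ₐ[R] (ι → R)`, in particular `B` is
  (finite) étale over `R`.

Everything is [folklore] and PROVED; no definitions, no named facts.

## Sources

* A. J. de Jong, *Smoothness, semi-stability and alterations*, Publ. Math. IHÉS 83 (1996), 4.12,
  p. 68 (the use). [DeJong1996]
* The Stacks Project, Tag 00U3 (étale algebras over fields are products of fields), Tag 03GE.
-/

noncomputable section

open Polynomial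

namespace Literature.AlgebraicGeometry.Resolution

universe u

/-! ## Idempotents are integral -/

/-- An idempotent of a `B`-algebra is integral over `B`: it is a root of the monic `X² - X`.
[folklore] -/
theorem isIntegral_of_isIdempotentElem {B E : Type*} [CommRing B] [CommRing E] [Algebra B E]
    {z : E} (hz : IsIdempotentElem z) : IsIntegral B z := by
  nontriviality B
  refine ⟨X ^ 2 - X, ?_, ?_⟩
  · exact (monic_X_pow 2).sub_of_left (by rw [degree_X_pow, degree_X]; norm_num)
  · simp [sq, hz.eq]

/-! ## Lifting the idempotents of an ambient product of fields -/

section Lift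

variable {R B E : Type*} [CommRing R] [CommRing B] [CommRing E] [Algebra B E] [Algebra R E]
  {ι : Type*} {F : ι → Type*} [∀ i, Field (F i)] [∀ i, Algebra R (F i)]

/-- **Idempotents of a product of fields in which `B` is integrally closed lie in `B`.** If
`B → E` is injective, every element of `E` integral over `B` comes from `B`, and
`E ≃ₐ[R] ∏ᵢ Fᵢ` with the `Fᵢ` fields, then there are complete orthogonal idempotents
`eᵢ ∈ B` mapping to the standard idempotents of `∏ᵢ Fᵢ`, and for each `i` the ideal `(1 - eᵢ)`
is exactly the kernel of the `i`-th coordinate `B → E ≃ ∏ Fⱼ → Fᵢ`. [folklore] -/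
theorem exists_completeOrthogonalIdempotents_of_integrallyClosedIn [Fintype ι] [DecidableEq ι]
    (hinj : Function.Injective (algebraMap B E))
    (hic : ∀ z : E, IsIntegral B z → z ∈ (algebraMap B E).range) (eE : E ≃ₐ[R] Π i, F i) :
    ∃ e : ι → B, CompleteOrthogonalIdempotents e ∧
      (∀ i, eE (algebraMap B E (e i)) = Pi.single i 1) ∧
      ∀ i b, b ∈ Ideal.span {1 - e i} ↔ eE (algebraMap B E b) i = 0 := by
  -- the standard idempotents of `∏ Fᵢ`, transported to `E`
  have hstd : CompleteOrthogonalIdempotents (fun i : ι => (Pi.single i 1 : Π i, F i)) :=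
    CompleteOrthogonalIdempotents.single F
  have hε : CompleteOrthogonalIdempotents
      ((eE.symm : (Π i, F i) ≃+* E).toRingHom ∘ fun i : ι => (Pi.single i 1 : Π i, F i)) :=
    hstd.map _
  -- each is integral over `B`, hence comes from `B`
  have hmem : ∀ i, ∃ b : B, algebraMap B E b = eE.symm (Pi.single i 1) := fun i => by
    obtain ⟨b, hb⟩ := hic _ (isIntegral_of_isIdempotentElem (hε.idem i))
    exact ⟨b, hb⟩
  choose e he using hmem
  have hcomp : (algebraMap B E : B →+* E) ∘ e =
      (eE.symm : (Π i, F i) ≃+* E).toRingHom ∘ fun i : ι => (Pi.single i 1 : Π i, F i) := by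
    funext i
    simp [he]
  have hB : CompleteOrthogonalIdempotents e := by
    rw [← CompleteOrthogonalIdempotents.map_injective_iff (algebraMap B E) hinj, hcomp]
    exact hε
  have hstdE : ∀ i, eE (algebraMap B E (e i)) = Pi.single i 1 := fun i => by
    rw [he]; simp
  refine ⟨e, hB, hstdE, fun i b => ⟨fun hb => ?_, fun hb => ?_⟩⟩
  · obtain ⟨c, rfl⟩ := Ideal.mem_span_singleton'.mp hb
    rw [map_mul, map_mul, map_sub, map_sub, map_one, map_one, hstdE]
    simp
  · -- `b eᵢ = 0`: its image in `∏ Fⱼ` is `x · δᵢ = δᵢ (x i) = 0`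
    have h1 : eE (algebraMap B E (b * e i)) = 0 := by
      rw [map_mul, map_mul, hstdE]
      ext j
      by_cases hj : j = i
      · subst hj; simp [hb]
      · simp [hj]
    have h2 : b * e i = 0 := hinj (by rw [map_zero]; exact eE.injective (by rw [map_zero, h1]))
    rw [Ideal.mem_span_singleton]
    exact ⟨b, by rw [sub_mul, one_mul, mul_comm (e i) b, h2, sub_zero]⟩

/-- Each factor `B ⧸ (1 - eᵢ)` embeds into the field `Fᵢ` (the ideal `(1 - eᵢ)` being the
kernel of the `i`-th coordinate), hence is a domain. [folklore] -/
theorem isDomain_quotient_span_one_sub (eE : E ≃ₐ[R] Π i, F i) {e : ι → B} (i : ι)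
    (hker : ∀ b, b ∈ Ideal.span {1 - e i} ↔ eE (algebraMap B E b) i = 0) :
    IsDomain (B ⧸ Ideal.span {1 - e i}) := by
  let φ : B →+* F i :=
    (Pi.evalRingHom F i).comp ((eE : E ≃+* Π i, F i).toRingHom.comp (algebraMap B E))
  have hφ : Ideal.span {1 - e i} = RingHom.ker φ := by
    ext b
    rw [hker, RingHom.mem_ker]
    rfl
  haveI : (Ideal.span {1 - e i}).IsPrime := by
    rw [hφ]
    exact RingHom.ker_isPrime _
  exact Ideal.Quotient.isDomain _

end Lift

/-! ## Factors with a retraction are trivial -/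

/-- **An integral domain extension with a retraction is trivial**: if `C` is a domain, integral
over `R`, and `s : C →ₐ[R] R` is an `R`-algebra retraction, then `R → C` is bijective (every
element of `C` equals the image of its retraction, `eq_algebraMap_of_retraction_of_isIntegral`).
[folklore] -/
theorem bijective_algebraMap_of_retraction {R C : Type*} [CommRing R] [CommRing C] [IsDomain C]
    [Algebra R C] [Algebra.IsIntegral R C] (s : C →ₐ[R] R) :
    Function.Bijective (algebraMap R C) := by
  refine ⟨fun a b h => ?_, fun c => ⟨s c, ?_⟩⟩
  · have := congrArg s h
    simpa using this
  · exact (eq_algebraMap_of_retraction_of_isIntegral s (Algebra.IsIntegral.isIntegral c)).symm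

section Retraction

variable {R B : Type*} [CommRing R] [CommRing B] [Algebra R B]

/-- An `R`-algebra map `s : B → R` with `s e = 1` kills `(1 - e)`, so it descends to an
`R`-algebra retraction of `B ⧸ (1 - e)`. [folklore] -/
theorem exists_retraction_quotient (s : B →ₐ[R] R) (e : B) (hs : s e = 1) :
    ∃ r : (B ⧸ Ideal.span {1 - e}) →ₐ[R] R, ∀ b, r (Ideal.Quotient.mk _ b) = s b :=
  ⟨Ideal.Quotient.liftₐ (Ideal.span {1 - e}) s (fun b hb => by
    obtain ⟨c, rfl⟩ := Ideal.mem_span_singleton'.mp hb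
    rw [map_mul, map_sub, map_one, hs, sub_self, mul_zero]), fun _ => rfl⟩

/-- **The factor of an idempotent met by a section is trivial**: if `B ⧸ (1 - e)` is a domain,
integral over `R`, and some `R`-algebra map `s : B → R` has `s e = 1`, then
`R → B ⧸ (1 - e)` is bijective. [folklore] -/
theorem bijective_algebraMap_quotient_of_apply_eq_one (s : B →ₐ[R] R) (e : B) (hs : s e = 1)
    [IsDomain (B ⧸ Ideal.span {1 - e})] [Algebra.IsIntegral R (B ⧸ Ideal.span {1 - e})] :
    Function.Bijective (algebraMap R (B ⧸ Ideal.span {1 - e})) := by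
  obtain ⟨r, -⟩ := exists_retraction_quotient s e hs
  exact bijective_algebraMap_of_retraction r

/-- The value of an `R`-algebra map on an idempotent is an idempotent of `R`; if `R` has only
the trivial idempotents it is `0` or `1`. [folklore] -/
theorem apply_idem_eq_zero_or_one (hconn : ∀ r : R, IsIdempotentElem r → r = 0 ∨ r = 1)
    (s : B →ₐ[R] R) {e : B} (he : IsIdempotentElem e) : s e = 0 ∨ s e = 1 :=
  hconn _ (he.map s)

/-- With complete orthogonal idempotents `eᵢ` and `R` having only trivial idempotents, an
`R`-algebra map `s : B → R` takes the value `1` on exactly one `eᵢ` — in particular on some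
`eᵢ`. [folklore] -/
theorem exists_apply_idem_eq_one [Nontrivial R]
    (hconn : ∀ r : R, IsIdempotentElem r → r = 0 ∨ r = 1)
    (s : B →ₐ[R] R) {ι : Type*} [Fintype ι] {e : ι → B} (he : CompleteOrthogonalIdempotents e) :
    ∃ i, s (e i) = 1 := by
  by_contra h
  push Not at h
  have h0 : ∀ i, s (e i) = 0 := fun i =>
    (apply_idem_eq_zero_or_one hconn s (he.idem i)).resolve_right (h i)
  have := congrArg s he.complete
  rw [map_sum, map_one] at this
  simp [h0] at this

end Retraction

/-! ## All factors trivial: `B ≃ Rⁿ` is étale -/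

section Split

variable {R B : Type u} [CommRing R] [CommRing B] [Algebra R B] {ι : Type u} [Fintype ι]
  {e : ι → B}

/-- If `eᵢ` are complete orthogonal idempotents of the `R`-algebra `B` and every
`R → B ⧸ (1 - eᵢ)` is bijective, then `B ≃ₐ[R] (ι → R)` (through `B ≃ ∏ᵢ B ⧸ (1 - eᵢ)`,
`CompleteOrthogonalIdempotents.bijective_pi`). [folklore] -/
theorem exists_algEquiv_pi_of_bijective (he : CompleteOrthogonalIdempotents e)
    (hgood : ∀ i, Function.Bijective (algebraMap R (B ⧸ Ideal.span {1 - e i}))) :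
    ∃ Φ : B ≃ₐ[R] (ι → R), ∀ b i, algebraMap R _ (Φ b i) = Ideal.Quotient.mk (Ideal.span {1 - e i}) b := by
  -- `B → ∏ B ⧸ (1 - eᵢ)` is a bijective `R`-algebra map
  let ψ : B →ₐ[R] Π i, B ⧸ Ideal.span {1 - e i} :=
    AlgHom.pi fun i => Ideal.Quotient.mkₐ R (Ideal.span {1 - e i})
  have hψ : Function.Bijective ψ := by
    have h := he.bijective_pi
    have hcoe : ⇑ψ = ⇑(RingHom.pi fun i => Ideal.Quotient.mk (Ideal.span {1 - e i})) := by
      funext b; funext i; rfl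
    rw [hcoe]
    exact h
  let Ψ : B ≃ₐ[R] Π i, B ⧸ Ideal.span {1 - e i} := AlgEquiv.ofBijective ψ hψ
  -- each factor is `R`
  let θ : ∀ i, (B ⧸ Ideal.span {1 - e i}) ≃ₐ[R] R := fun i =>
    (AlgEquiv.ofBijective (Algebra.ofId R (B ⧸ Ideal.span {1 - e i})) (hgood i)).symm
  refine ⟨Ψ.trans (AlgEquiv.piCongrRight θ), fun b i => ?_⟩
  have hθ : ∀ i (x : B ⧸ Ideal.span {1 - e i}), algebraMap R _ (θ i x) = x := fun i x => by
    have h := (AlgEquiv.ofBijective (Algebra.ofId R (B ⧸ Ideal.span {1 - e i}))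
      (hgood i)).apply_symm_apply x
    rw [AlgEquiv.ofBijective_apply, Algebra.ofId_apply] at h
    exact h
  simp only [AlgEquiv.trans_apply, AlgEquiv.piCongrRight_apply]
  rw [hθ]
  rfl

/-- **A finite split algebra is étale**: under the hypotheses of `exists_algEquiv_pi_of_bijective`,
`B` is étale over `R` (`Rⁿ` is, and étaleness transports along `R`-algebra isomorphisms).
[folklore] -/
theorem etale_of_completeOrthogonalIdempotents_of_bijective (he : CompleteOrthogonalIdempotents e)
    (hgood : ∀ i, Function.Bijective (algebraMap R (B ⧸ Ideal.span {1 - e i}))) :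
    Algebra.Etale R B := by
  obtain ⟨Φ, -⟩ := exists_algEquiv_pi_of_bijective he hgood
  haveI : Algebra.Etale R (ι → R) := inferInstance
  exact Algebra.Etale.of_equiv Φ.symm

end Split

/-! ## Ring-equivalence variants

In applications the ambient product of fields `E ≃ ∏ Fᵢ` comes from the structure theorem for
étale algebras over a field (`Algebra.Etale.iff_exists_algEquiv_prod`), as an equivalence over
that field, not over the ring `R` of interest; only its ring structure matters, so we record the
lifting statements for a plain ring isomorphism (through the `ℤ`-algebra case). -/

section LiftRing

variable {B E : Type*} [CommRing B] [CommRing E] [Algebra B E]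
  {ι : Type*} {F : ι → Type*} [∀ i, Field (F i)]

/-- `exists_completeOrthogonalIdempotents_of_integrallyClosedIn` for a ring isomorphism
`E ≃+* ∏ᵢ Fᵢ`. [folklore] -/
theorem exists_completeOrthogonalIdempotents_of_integrallyClosedIn' [Fintype ι] [DecidableEq ι]
    (hinj : Function.Injective (algebraMap B E))
    (hic : ∀ z : E, IsIntegral B z → z ∈ (algebraMap B E).range) (eE : E ≃+* Π i, F i) :
    ∃ e : ι → B, CompleteOrthogonalIdempotents e ∧
      (∀ i, eE (algebraMap B E (e i)) = Pi.single i 1) ∧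
      ∀ i b, b ∈ Ideal.span {1 - e i} ↔ eE (algebraMap B E b) i = 0 :=
  exists_completeOrthogonalIdempotents_of_integrallyClosedIn (R := ℤ) hinj hic
    (AlgEquiv.ofRingEquiv (f := eE) (fun n => by simp))

/-- `isDomain_quotient_span_one_sub` for a ring isomorphism `E ≃+* ∏ᵢ Fᵢ`. [folklore] -/
theorem isDomain_quotient_span_one_sub' (eE : E ≃+* Π i, F i) {e : ι → B} (i : ι)
    (hker : ∀ b, b ∈ Ideal.span {1 - e i} ↔ eE (algebraMap B E b) i = 0) :
    IsDomain (B ⧸ Ideal.span {1 - e i}) :=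
  isDomain_quotient_span_one_sub (R := ℤ) (AlgEquiv.ofRingEquiv (f := eE) (fun n => by simp)) i
    hker

end LiftRing

end Literature.AlgebraicGeometry.Resolution

end
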